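import Mathlib.Logic.Equiv.Fin.Basic
import Literature.Computability.Complexity.Randomized
import HarnessLib

/-!
# Union bound and fresh coin blocks for `uniformProb` (trunk CplxCore)

Two counting principles for the uniform distribution on coin strings `{0,1}^m`
(`uniformProb m E = #{r ∈ {0,1}^m | r ∈ E} / 2^m`, `Randomized.lean`) that every randomised
reduction with several sub-routine calls uses (Arora–Barak 2009, §7.4.1 "error reduction" and the
union bound; Aaronson–Arkhipov 2013, proof of Thm. 1.1, p. 178: each of the polynomially many
oracle calls gets fresh coins and fails with probability `≤ 1/k`, "so by the union bound …"):

* `uniformProb_union_le`, `uniformProb_biUnion_le` — the **union bound**;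
* `uniformProb_block_le` — **fresh coins**: if the block `r[a, a + ℓ)` of the coin string is
  tested against a bad set `B (r ↾ a)` that may depend on the *earlier* coins, and every such bad
  set has probability `≤ δ`, then the event "the block is bad" has probability `≤ δ`
  (counting over `{0,1}^{a + ℓ + d} ≃ {0,1}^a × {0,1}^ℓ × {0,1}^d`, `Fin.appendEquiv`);
* `uniformProb_exists_badBlock_le` — hence for `Q` consecutive blocks of length `ℓ` with
  adaptively chosen bad sets of probability `≤ δ` each, "some block is bad" has probability
  `≤ Q · δ`;
* `uniformProb_block_le'`, `uniformProb_exists_badBlock_le'` — the same with bad sets depending on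
  all coins outside the block (blocks assigned to call sites by any injective map).

Also `uniformProb_eq_card_fun`: `uniformProb` counted over `Fin m → Bool` (`Equiv.vectorEquivFin`),
the form in which product decompositions are convenient.

## References

* S. Arora, B. Barak, *Computational Complexity: A Modern Approach*, CUP 2009, §7.4.1 (error
  reduction, union bound), §A.2 (probability: union bound, independence of disjoint coins).
* S. Aaronson, A. Arkhipov, *The computational complexity of linear optics*, Theory of
  Computing 9 (2013), proof of Thm. 1.1 (p. 178).
-/

namespace Literature.Computability.Complexity

open _root_.Computability Finset

open scoped Classical

/-! ### Counting over `Fin m → Bool` -/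

/-- **`uniformProb` counted over functions**: `Pr_{r ∈ {0,1}^m}[r ∈ E] = #{f : Fin m → Bool | ofFn f ∈ E} / 2^m`. [Arora–Barak 2009, §7.1] [cite: AroraBarak2009, §7.1] -/
theorem uniformProb_eq_card_fun (m : ℕ) (E : Set (List Bool)) :
    uniformProb m E = ((univ.filter fun f : Fin m → Bool => List.ofFn f ∈ E).card : ℝ) / 2 ^ m := by
  unfold uniformProb
  congr 2
  refine card_equiv (Equiv.vectorEquivFin Bool m) fun r => ?_
  simp only [mem_filter, mem_univ, true_and, Equiv.vectorEquivFin, Equiv.coe_fn_mk]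
  rw [← List.Vector.toList_ofFn, List.Vector.ofFn_get]

/-- The number of Boolean functions on `Fin m` is `2^m`. [folklore] -/
theorem card_fun_fin_bool (m : ℕ) : Fintype.card (Fin m → Bool) = 2 ^ m := by
  simp

/-! ### The union bound -/

/-- **Union bound** for two events. [Arora–Barak 2009, §A.2] [cite: AroraBarak2009, §A.2] -/
theorem uniformProb_union_le (m : ℕ) (E F : Set (List Bool)) :
    uniformProb m (E ∪ F) ≤ uniformProb m E + uniformProb m F := by
  unfold uniformProb
  rw [← add_div]
  refine div_le_div_of_nonneg_right ?_ (by positivity)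
  exact_mod_cast (card_le_card fun r hr => by
    simpa only [mem_union, mem_filter, mem_univ, true_and, Set.mem_union] using hr).trans (card_union_le _ _)

/-- **Union bound** for finitely many events. [Arora–Barak 2009, §A.2] [cite: AroraBarak2009, §A.2] -/
theorem uniformProb_biUnion_le {ι : Type*} (m : ℕ) (s : Finset ι) (E : ι → Set (List Bool)) :
    uniformProb m (⋃ i ∈ s, E i) ≤ ∑ i ∈ s, uniformProb m (E i) := by
  induction s using Finset.induction_on with
  | empty => simp
  | insert a s ha ih =>
    rw [Finset.set_biUnion_insert, Finset.sum_insert ha]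
    exact (uniformProb_union_le m _ _).trans (by linarith)

/-! ### Fresh coin blocks -/

/-- **Fresh coins.** On coin strings of length `a + ℓ + d`, consider the event that the block
`(r.drop a).take ℓ` lies in a bad set `B (r.take a)` depending on the earlier coins only. If every
bad set has probability `≤ δ` (over `{0,1}^ℓ`), the event has probability `≤ δ`. [Arora–Barak 2009, §7.4.1, §A.2] [cite: AroraBarak2009, §7.4.1] -/
theorem uniformProb_block_le {a ℓ d : ℕ} (B : List Bool → Set (List Bool)) {δ : ℝ}
    (hδ : ∀ w : List Bool, w.length = a → uniformProb ℓ (B w) ≤ δ) :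
    uniformProb (a + ℓ + d) {r | (r.drop a).take ℓ ∈ B (r.take a)} ≤ δ := by
  -- transport to triples of functions
  set e : ((Fin a → Bool) × (Fin ℓ → Bool)) × (Fin d → Bool) ≃ (Fin (a + ℓ + d) → Bool) :=
    (Equiv.prodCongr (Fin.appendEquiv a ℓ) (Equiv.refl _)).trans (Fin.appendEquiv (a + ℓ) d) with he
  set T : Finset (((Fin a → Bool) × (Fin ℓ → Bool)) × (Fin d → Bool)) :=
    univ.filter fun p => List.ofFn p.1.2 ∈ B (List.ofFn p.1.1) with hT
  have hcard : uniformProb (a + ℓ + d) {r | (r.drop a).take ℓ ∈ B (r.take a)} = (T.card : ℝ) / 2 ^ (a + ℓ + d) := by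
    rw [uniformProb_eq_card_fun]
    congr 2
    symm
    refine card_equiv e fun p => ?_
    obtain ⟨⟨u, v⟩, w⟩ := p
    have hsplit : List.ofFn (e ((u, v), w)) = (List.ofFn u ++ List.ofFn v) ++ List.ofFn w := by
      simp [he, Fin.appendEquiv, List.ofFn_fin_append]
    have hu : (List.ofFn u).length = a := List.length_ofFn
    have hv : (List.ofFn v).length = ℓ := List.length_ofFn
    simp only [hT, mem_filter, mem_univ, true_and, Set.mem_setOf_eq, hsplit, List.append_assoc]
    rw [List.take_left' hu, List.drop_left' hu, List.take_left' hv]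
  -- the predicate ignores the last block
  set T₁ : Finset ((Fin a → Bool) × (Fin ℓ → Bool)) :=
    univ.filter fun q => List.ofFn q.2 ∈ B (List.ofFn q.1) with hT₁
  have hT' : T = T₁ ×ˢ (univ : Finset (Fin d → Bool)) := by
    rw [hT, hT₁]
    exact Finset.ext fun p => by simp
  have hcardT : T.card = T₁.card * 2 ^ d := by
    rw [hT', card_product, card_univ, card_fun_fin_bool]
  -- fibrewise over the first block
  have hfib : T₁.card = ∑ u : Fin a → Bool, (univ.filter fun v : Fin ℓ → Bool => List.ofFn v ∈ B (List.ofFn u)).card := by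
    rw [card_eq_sum_card_fiberwise (f := Prod.fst) (t := univ) (fun _ _ => mem_univ _)]
    refine sum_congr rfl fun u _ => ?_
    rw [← card_image_of_injective (univ.filter fun v : Fin ℓ → Bool => List.ofFn v ∈ B (List.ofFn u))
      (Prod.mk_right_injective u)]
    congr 1
    refine Finset.ext fun q => ?_
    obtain ⟨u', v⟩ := q
    simp only [hT₁, mem_filter, mem_univ, true_and, mem_image, Prod.mk.injEq]
    constructor
    · rintro ⟨h, rfl⟩; exact ⟨v, h, rfl, rfl⟩
    · rintro ⟨v', h, rfl, rfl⟩; exact ⟨h, rfl⟩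
  -- each fibre is a bad set of probability `≤ δ`
  have hblock : ∀ u : Fin a → Bool,
      ((univ.filter fun v : Fin ℓ → Bool => List.ofFn v ∈ B (List.ofFn u)).card : ℝ) ≤ δ * 2 ^ ℓ := by
    intro u
    have h := hδ (List.ofFn u) List.length_ofFn
    rw [uniformProb_eq_card_fun, div_le_iff₀ (by positivity)] at h
    exact h
  have hsum : (T₁.card : ℝ) ≤ 2 ^ a * (δ * 2 ^ ℓ) := by
    rw [hfib]
    push_cast
    calc ∑ u : Fin a → Bool, ((univ.filter fun v : Fin ℓ → Bool => List.ofFn v ∈ B (List.ofFn u)).card : ℝ)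
        ≤ ∑ _u : Fin a → Bool, δ * 2 ^ ℓ := sum_le_sum fun u _ => hblock u
      _ = 2 ^ a * (δ * 2 ^ ℓ) := by rw [sum_const, card_univ, card_fun_fin_bool, nsmul_eq_mul]; push_cast; ring
  rw [hcard, div_le_iff₀ (by positivity), hcardT]
  push_cast
  have h2 : (0 : ℝ) ≤ 2 ^ d := by positivity
  calc (T₁.card : ℝ) * 2 ^ d ≤ 2 ^ a * (δ * 2 ^ ℓ) * 2 ^ d := mul_le_mul_of_nonneg_right hsum h2
    _ = δ * 2 ^ (a + ℓ + d) := by rw [pow_add, pow_add]; ring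

/-- **Some fresh block is bad, adaptively**: for `Q` consecutive blocks of length `ℓ` of a coin
string of length `m ≥ Q · ℓ`, with bad sets `B i (r ↾ iℓ)` for block `i` chosen after seeing the
earlier coins, each of probability `≤ δ`, the probability that some block is bad is `≤ Q · δ`
(fresh coins and the union bound). [Arora–Barak 2009, §7.4.1; Aaronson–Arkhipov 2013, proof of Thm. 1.1 (p. 178)] [cite: AroraBarak2009, §7.4.1] -/
theorem uniformProb_exists_badBlock_le {ℓ Q m : ℕ} (hm : Q * ℓ ≤ m) (B : ℕ → List Bool → Set (List Bool))
    {δ : ℝ} (hδ : ∀ i < Q, ∀ w : List Bool, w.length = i * ℓ → uniformProb ℓ (B i w) ≤ δ) :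
    uniformProb m {r | ∃ i < Q, (r.drop (i * ℓ)).take ℓ ∈ B i (r.take (i * ℓ))} ≤ Q * δ := by
  have hset : {r : List Bool | ∃ i < Q, (r.drop (i * ℓ)).take ℓ ∈ B i (r.take (i * ℓ))} =
      ⋃ i ∈ Finset.range Q, {r | (r.drop (i * ℓ)).take ℓ ∈ B i (r.take (i * ℓ))} := by
    ext r; simp
  rw [hset]
  refine (uniformProb_biUnion_le m _ _).trans ?_
  calc ∑ i ∈ Finset.range Q, uniformProb m {r | (r.drop (i * ℓ)).take ℓ ∈ B i (r.take (i * ℓ))}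
      ≤ ∑ _i ∈ Finset.range Q, δ := by
        refine sum_le_sum fun i hi => ?_
        have hi' : i < Q := Finset.mem_range.1 hi
        obtain ⟨d, hd⟩ : ∃ d, m = i * ℓ + ℓ + d := by
          refine ⟨m - (i * ℓ + ℓ), ?_⟩
          have : (i + 1) * ℓ ≤ Q * ℓ := Nat.mul_le_mul_right ℓ hi'
          rw [Nat.succ_mul] at this
          omega
        rw [hd]
        exact uniformProb_block_le (B i) fun w hw => hδ i hi' w hw
    _ = Q * δ := by rw [sum_const, card_range, nsmul_eq_mul]

/-- **Fresh coins, two-sided**: the same when the bad set may depend on all coins *outside* the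
block, `B (r.take a) (r.drop (a + ℓ))` — conditioned on the other coordinates the block is still
uniform. This is the form needed when coin blocks are assigned to the call sites of a randomised
reduction by any injective map (not necessarily in the order of use). [Arora–Barak 2009, §7.4.1, §A.2] [cite: AroraBarak2009, §7.4.1] -/
theorem uniformProb_block_le' {a ℓ d : ℕ} (B : List Bool → List Bool → Set (List Bool)) {δ : ℝ}
    (hδ : ∀ w w' : List Bool, w.length = a → w'.length = d → uniformProb ℓ (B w w') ≤ δ) :
    uniformProb (a + ℓ + d) {r | (r.drop a).take ℓ ∈ B (r.take a) (r.drop (a + ℓ))} ≤ δ := by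
  set e : ((Fin a → Bool) × (Fin ℓ → Bool)) × (Fin d → Bool) ≃ (Fin (a + ℓ + d) → Bool) :=
    (Equiv.prodCongr (Fin.appendEquiv a ℓ) (Equiv.refl _)).trans (Fin.appendEquiv (a + ℓ) d) with he
  set T : Finset (((Fin a → Bool) × (Fin ℓ → Bool)) × (Fin d → Bool)) :=
    univ.filter fun p => List.ofFn p.1.2 ∈ B (List.ofFn p.1.1) (List.ofFn p.2) with hT
  have hcard : uniformProb (a + ℓ + d) {r | (r.drop a).take ℓ ∈ B (r.take a) (r.drop (a + ℓ))} =
      (T.card : ℝ) / 2 ^ (a + ℓ + d) := by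
    rw [uniformProb_eq_card_fun]
    congr 2
    symm
    refine card_equiv e fun p => ?_
    obtain ⟨⟨u, v⟩, w⟩ := p
    have hsplit : List.ofFn (e ((u, v), w)) = (List.ofFn u ++ List.ofFn v) ++ List.ofFn w := by
      simp [he, Fin.appendEquiv, List.ofFn_fin_append]
    have hu : (List.ofFn u).length = a := List.length_ofFn
    have hv : (List.ofFn v).length = ℓ := List.length_ofFn
    have huv : (List.ofFn u ++ List.ofFn v).length = a + ℓ := by simp
    simp only [hT, mem_filter, mem_univ, true_and, Set.mem_setOf_eq, hsplit]
    rw [List.drop_left' huv, List.append_assoc, List.take_left' hu, List.drop_left' hu, List.take_left' hv]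
  -- fibrewise over (first block, last block)
  have hfib : T.card = ∑ uw : (Fin a → Bool) × (Fin d → Bool),
      (univ.filter fun v : Fin ℓ → Bool => List.ofFn v ∈ B (List.ofFn uw.1) (List.ofFn uw.2)).card := by
    rw [card_eq_sum_card_fiberwise (f := fun p : ((Fin a → Bool) × (Fin ℓ → Bool)) × (Fin d → Bool) => (p.1.1, p.2))
      (t := univ) (fun _ _ => mem_univ _)]
    refine sum_congr rfl fun uw _ => ?_
    obtain ⟨u, w⟩ := uw
    have hinj : Function.Injective (fun v : Fin ℓ → Bool => ((u, v), w)) := fun v v' h => by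
      simpa using h
    rw [← card_image_of_injective (univ.filter fun v : Fin ℓ → Bool => List.ofFn v ∈ B (List.ofFn u) (List.ofFn w)) hinj]
    congr 1
    refine Finset.ext fun q => ?_
    obtain ⟨⟨u', v⟩, w'⟩ := q
    simp only [hT, mem_filter, mem_univ, true_and, mem_image, Prod.mk.injEq]
    constructor
    · rintro ⟨h, rfl, rfl⟩; exact ⟨v, h, ⟨rfl, rfl⟩, rfl⟩
    · rintro ⟨v', h, ⟨rfl, rfl⟩, rfl⟩; exact ⟨h, rfl, rfl⟩
  have hblock : ∀ uw : (Fin a → Bool) × (Fin d → Bool),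
      ((univ.filter fun v : Fin ℓ → Bool => List.ofFn v ∈ B (List.ofFn uw.1) (List.ofFn uw.2)).card : ℝ) ≤ δ * 2 ^ ℓ := by
    intro uw
    have h := hδ (List.ofFn uw.1) (List.ofFn uw.2) List.length_ofFn List.length_ofFn
    rw [uniformProb_eq_card_fun, div_le_iff₀ (by positivity)] at h
    exact h
  rw [hcard, div_le_iff₀ (by positivity), hfib]
  push_cast
  calc ∑ uw : (Fin a → Bool) × (Fin d → Bool),
        ((univ.filter fun v : Fin ℓ → Bool => List.ofFn v ∈ B (List.ofFn uw.1) (List.ofFn uw.2)).card : ℝ)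
      ≤ ∑ _uw : (Fin a → Bool) × (Fin d → Bool), δ * 2 ^ ℓ := sum_le_sum fun uw _ => hblock uw
    _ = δ * 2 ^ (a + ℓ + d) := by
        rw [sum_const, card_univ, Fintype.card_prod, card_fun_fin_bool, card_fun_fin_bool, nsmul_eq_mul, pow_add,
          pow_add]
        push_cast
        ring

/-- **Some block is bad, for any family of blocks with two-sided adaptive bad sets**: for `Q`
consecutive blocks of length `ℓ` in a coin string of length `m ≥ Qℓ`, with bad sets
`B i (coins before block i) (coins after block i)` of probability `≤ δ` each, the probability
that some block is bad is `≤ Q · δ`. [Arora–Barak 2009, §7.4.1] [cite: AroraBarak2009, §7.4.1] -/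
theorem uniformProb_exists_badBlock_le' {ℓ Q m : ℕ} (hm : Q * ℓ ≤ m)
    (B : ℕ → List Bool → List Bool → Set (List Bool)) {δ : ℝ}
    (hδ : ∀ i < Q, ∀ w w' : List Bool, w.length = i * ℓ → w'.length = m - (i * ℓ + ℓ) → uniformProb ℓ (B i w w') ≤ δ) :
    uniformProb m {r | ∃ i < Q, (r.drop (i * ℓ)).take ℓ ∈ B i (r.take (i * ℓ)) (r.drop (i * ℓ + ℓ))} ≤ Q * δ := by
  have hset : {r : List Bool | ∃ i < Q, (r.drop (i * ℓ)).take ℓ ∈ B i (r.take (i * ℓ)) (r.drop (i * ℓ + ℓ))} =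
      ⋃ i ∈ Finset.range Q, {r | (r.drop (i * ℓ)).take ℓ ∈ B i (r.take (i * ℓ)) (r.drop (i * ℓ + ℓ))} := by
    ext r; simp
  rw [hset]
  refine (uniformProb_biUnion_le m _ _).trans ?_
  calc ∑ i ∈ Finset.range Q, uniformProb m {r | (r.drop (i * ℓ)).take ℓ ∈ B i (r.take (i * ℓ)) (r.drop (i * ℓ + ℓ))}
      ≤ ∑ _i ∈ Finset.range Q, δ := by
        refine sum_le_sum fun i hi => ?_
        have hi' : i < Q := Finset.mem_range.1 hi
        obtain ⟨d, hd⟩ : ∃ d, m = i * ℓ + ℓ + d := by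
          refine ⟨m - (i * ℓ + ℓ), ?_⟩
          have : (i + 1) * ℓ ≤ Q * ℓ := Nat.mul_le_mul_right ℓ hi'
          rw [Nat.succ_mul] at this
          omega
        have hd' : m - (i * ℓ + ℓ) = d := by omega
        rw [hd]
        exact uniformProb_block_le' (B i) fun w w' hw hw' => hδ i hi' w w' hw (by rw [hd']; exact hw')
    _ = Q * δ := by rw [sum_const, card_range, nsmul_eq_mul]

end Literature.Computability.Complexity
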